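import Summits.BirchSwinnertonDyer.BirchSwinnertonDyer.Theorems.KolyvaginRoadThreeMethod2ParityRank
import Literature.NumberTheory.EllipticCurves.HeegnerPointsKolyvaginProp21Proofs
import Literature.NumberTheory.EllipticCurves.McCallum1991.EigenclassesCebotarevLevelPow
import Literature.NumberTheory.EllipticCurves.BSDSelmerSkinnerProofs
import Literature.NumberTheory.GaloisRepresentations.LocalGlobalCohomology
import HarnessLib

/-!
# KOLY method line, crux stmt-BirchSwinnertonDyer-19574 `ZhangSharpFrameAtThreeHL`: the two ČEBOTAREV inputs (Cheb) of
# the S2 engine DISCHARGED from McCallum's Cor. 3.2 for eigenclasses (a tree THEOREM) (cell `bsd-stepL`, seat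
# `bsd-stepL-zhang3-p1` g8; `--supports 19574`, helper; item 6 of the S2-ENGINE work package of the v3 re-line, memo
# `HOME/zhang3/S2-RELINE-19574.md` §2)

The engine-of-Kolyvagin-systems (`ZhangTriangulation.exists_ne_zero_of_zhangInduction_on_of_kolyvaginSystem_finite*`)
and its dictionary layer `Method2.inductionOfLevelSystems_of_dictionaries` (p499103) take two Čebotarev inputs over a
place-indexed apparatus with localisations `loc v`: (Cheb1) every non-zero class of `H¹(K, E[3])` is seen by the
localisation at some Kolyvagin prime outside any finite set; (Cheb2) two non-zero classes of OPPOSITE signs are seen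
simultaneously at some Kolyvagin prime outside any finite set (W. Zhang 2014, Lemma 8.1 = McCallum 1991, Prop. 3.1).
Here both are PROVED for any apparatus satisfying the strict-vanishing dictionary `torsionLocalKer_v = ker loc_v` at
the finite places, from the tree THEOREM `McCallum1991_cor_3_2_eigen_holds` (McCallum Cor. 3.2 for `τ`-eigenclasses,
`M = 1`; proved in the tree from Čebotarev for Artin representations and the Weil pairing): Kolyvagin primes in Gross's
sense (`IsKolyvaginPrime`, `Frob(ℓ) = Frob(∞)` on `K(E[3])`) are Zhang's (`Zhang2014.IsKolyvaginPrime`, index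
`M(ℓ) ≥ 1`) by `McCallum1991.le_kolyvaginIndex_of_frobEqFrobInfty`; a general class is handled through its two
eigen-components (`3` is odd); independence of one non-zero class, resp. of two non-zero classes of opposite signs, is
elementary in the `𝔽₃`-space `H¹(K, E[3])`. Frame inputs used: `K` imaginary quadratic, complex conjugation `c ≠ 1`,
`ρ̄_{E,3}` onto, multiplicative reduction at `3` (⟹ no CM). 0 definitions, 0 facts, 0 `sorry`; closes nothing (T7).

References: [cite: WZhang2014, Lemma 8.1] [cite: McCallumLMS1991, §3 Prop. 3.1, Cor. 3.2] [cite: GrossLMS1991, §3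
(3.1)–(3.3), §9].
-/

noncomputable section

open scoped Classical

namespace Summit.BirchSwinnertonDyer.Rank1Residual.X11b.Three.Koly.Method2

open WeierstrassCurve NumberField IsDedekindDomain
  Literature.NumberTheory.EllipticCurves Literature.NumberTheory.EllipticCurves.ModularForms
  Literature.NumberTheory.GaloisRepresentations Module

variable (W : WeierstrassCurve ℚ) (K : Type) [Field K] [NumberField K]

/-! ## §1 Arithmetic in the `𝔽₃`-space `H¹(K, E[3])` -/

/-- `2 • z = 0 ⟹ z = 0` in any `ZMod 3`-module (`3 • z = 0`, `z = 3 • z − 2 • z`). [folklore] -/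
theorem eq_zero_of_two_zsmul_eq_zero_of_module {M : Type*} [AddCommGroup M] [Module (ZMod 3) M] {z : M}
    (h : (2 : ℤ) • z = 0) : z = 0 := by
  have h3 : (3 : ℤ) • z = 0 := by
    rw [← Int.cast_smul_eq_zsmul (R := ZMod 3) (3 : ℤ) z]
    have h0 : ((3 : ℤ) : ZMod 3) = 0 := by decide
    rw [h0, zero_smul]
  have key : z = (3 : ℤ) • z + (-2 : ℤ) • z := by
    rw [← add_zsmul]
    norm_num
  rw [key, h3, neg_zsmul, h, neg_zero, add_zero]

/-- An integer multiple `a • x` with `3 ∤ a` vanishes only if `x = 0` (`3 • x = 0`, Bezout). [folklore] -/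
theorem eq_zero_of_zsmul_eq_zero_of_not_dvd {a : ℤ} (ha : ¬ (3 : ℤ) ∣ a) {x : V3 W K} (h : a • x = 0) : x = 0 := by
  have hcop : IsCoprime (3 : ℤ) a := (Int.prime_three.irreducible.coprime_iff_not_dvd).mpr ha
  obtain ⟨u, v, huv⟩ := hcop
  calc x = (u * 3 + v * a) • x := by rw [huv, one_zsmul]
    _ = u • ((3 : ℤ) • x) + v • (a • x) := by rw [add_zsmul, mul_zsmul, mul_zsmul]
    _ = 0 := by rw [h, three_smul_eq_zero W K x, zsmul_zero, zsmul_zero, add_zero]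

/-- `3 ∣ a` whenever `a • x = 0` for a NON-ZERO class `x`. [folklore] -/
theorem dvd_of_zsmul_eq_zero {a : ℤ} {x : V3 W K} (hx : x ≠ 0) (h : a • x = 0) : (3 : ℤ) ∣ a := by
  by_contra ha
  exact hx (eq_zero_of_zsmul_eq_zero_of_not_dvd W K ha h)

/-- **Independence of two non-zero classes of opposite signs** (for an additive involution-like `τ` acting by `e` and
`−e`, `e = ±1`): `a • x + b • y = 0 ⟹ 3 ∣ a ∧ 3 ∣ b`. Apply `τ`, subtract ∕ add, use `2 • z = 0 ⟹ z = 0`.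
[cite: McCallumLMS1991, §3 (independent classes)] -/
theorem dvd_and_dvd_of_zsmul_add_zsmul_eq_zero (τ : V3 W K →+ V3 W K) {e : ℤ} (he : e = 1 ∨ e = -1)
    {x y : V3 W K} (hx : τ x = e • x) (hy : τ y = (-e) • y) (hx0 : x ≠ 0) (hy0 : y ≠ 0) {a b : ℤ}
    (h : a • x + b • y = 0) : (3 : ℤ) ∣ a ∧ (3 : ℤ) ∣ b := by
  have hτ : e • (a • x - b • y) = 0 := by
    have h' := congrArg τ h
    rw [map_add, map_zsmul, map_zsmul, hx, hy, map_zero, smul_comm a e x, smul_comm b (-e) y, neg_zsmul,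
      ← sub_eq_add_neg, ← zsmul_sub] at h'
    exact h'
  have hdiff : a • x - b • y = 0 := by
    rcases he with rfl | rfl
    · rwa [one_zsmul] at hτ
    · rwa [neg_one_zsmul, neg_eq_zero] at hτ
  have ha : (2 : ℤ) • (a • x) = 0 := by
    rw [two_zsmul]
    calc a • x + a • x = (a • x + b • y) + (a • x - b • y) := by abel
      _ = 0 := by rw [h, hdiff, add_zero]
  have hb : (2 : ℤ) • (b • y) = 0 := by
    rw [two_zsmul]
    calc b • y + b • y = (a • x + b • y) - (a • x - b • y) := by abel
      _ = 0 := by rw [h, hdiff, sub_zero]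
  exact ⟨dvd_of_zsmul_eq_zero W K hx0 (eq_zero_of_zsmul_eq_zero_of_not_dvd W K (by decide) ha),
    dvd_of_zsmul_eq_zero W K hy0 (eq_zero_of_zsmul_eq_zero_of_not_dvd W K (by decide) hb)⟩

/-! ## §2 Gross's Kolyvagin primes at `p = 3` are Zhang's -/

variable [W.IsElliptic] [W.IsGloballyMinimal]

/-- A Kolyvagin prime in Gross's sense at `p = 3` (`Frob(ℓ) = Frob(∞)` on `K(E[3])`) is a Kolyvagin prime in Zhang's
sense (index `M(ℓ) ≥ 1`: `3 ∣ ℓ + 1`, `3 ∣ a_ℓ`).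
[cite: GrossLMS1991, §3 (3.2)–(3.3)] [cite: WZhang2014, Notations (xii)] -/
theorem zhang_isKolyvaginPrime_three_of_gross {ℓ : ℕ}
    (hℓ : IsKolyvaginPrime (W.conductorNorm ℤ) W K (3 ^ 1) ℓ) :
    Zhang2014.IsKolyvaginPrime (W.conductorNorm ℤ) W K 3 ℓ := by
  obtain ⟨hP, hN, hD, h3, hprime, hfrob⟩ := hℓ
  have h3' : ℓ ≠ 3 := by simpa using h3
  have hidx : 1 ≤ Zhang2014.kolyvaginIndex W 3 ℓ :=
    McCallum1991.le_kolyvaginIndex_of_frobEqFrobInfty W K Nat.prime_three (M := 1) le_rfl hP h3' hN hfrob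
  exact ⟨hP, hN, hD, h3', hprime, hidx⟩

/-! ## §3 (Cheb1) and (Cheb2) from McCallum's Cor. 3.2 for eigenclasses -/

variable [NeZero (W.conductorNorm ℤ)] (c : K ≃ₐ[ℚ] K) [Module (ZMod 3) (V3 W K)]

omit [Module (ZMod 3) (V3 W K)] in
/-- **McCallum's Cor. 3.2 at `p = 3`, read for the S2 engine**: for `r` eigenclasses `cs` (`τ cs i = ± cs i`),
independent (`∑ aᵢ csᵢ = 0 ⟹ 3 ∣ aᵢ`), and exponents `Nv i ≤ 1`, and any finite set `T` of Zhang–Kolyvagin primes, there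
is a Zhang–Kolyvagin prime `ℓ ∉ T` at whose place `cs i` is STRICT iff `Nv i = 0`. Frame: `K` imaginary quadratic,
`c ≠ 1`, `ρ̄_{E,3}` onto, multiplicative reduction at `3` (no CM). [cite: McCallumLMS1991, §3 Cor. 3.2] -/
theorem exists_zhangKolyvaginPrime_notMem_of_eigen (hK : IsImaginaryQuadratic K)
    (hmult : W.HasMultiplicativeReductionAtPrime 3) (hsurj : W.HasSurjectiveModNGaloisRep 3) (hc : c ≠ 1)
    {r : ℕ} (cs : Fin r → V3 W K)
    (hτ : ∀ i, ∃ e : ℤ, (e = 1 ∨ e = -1) ∧ conjAct W c ((3 ^ 1 : ℕ) : ℤ) (cs i) = e • cs i)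
    (Nv : Fin r → ℕ) (hN : ∀ i, Nv i ≤ 1) (hind : ∀ a : Fin r → ℤ, ∑ i, a i • cs i = 0 → ∀ i, (3 : ℤ) ∣ a i)
    (T : Finset {ℓ // Zhang2014.IsKolyvaginPrime (W.conductorNorm ℤ) W K 3 ℓ}) :
    ∃ ℓ : {ℓ // Zhang2014.IsKolyvaginPrime (W.conductorNorm ℤ) W K 3 ℓ}, ℓ ∉ T ∧
      ∀ i, ∀ v : HeightOneSpectrum (𝓞 K), ((ℓ : ℕ) : 𝓞 K) ∈ v.asIdeal →
        (cs i ∈ (W.baseChange K).torsionLocalKer (v.adicCompletion K) ((3 ^ 1 : ℕ) : ℤ) ↔ Nv i = 0) := by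
  haveI : Fact (Nat.Prime 3) := ⟨Nat.prime_three⟩
  have hCM : ¬ W.HasCM := not_hasCM_of_hasMultiplicativeReductionAtPrime' W hmult
  have hp : Nat.Prime (3 ^ 1) := by norm_num
  have hp2 : (3 ^ 1) ≠ 2 := by norm_num
  have hρ : W.HasSurjectiveModNGaloisRep (3 ^ 1) := by simpa using hsurj
  have hinf := McCallum1991_cor_3_2_eigen_holds (W.conductorNorm ℤ) W K hCM hK hp hp2 hρ c hc r cs hτ Nv hN
    (fun a ha i ↦ by exact_mod_cast hind a ha i)
  -- infinitely many Gross–Kolyvagin primes; pick one outside the (finitely many) primes of T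
  obtain ⟨ℓ, hℓmem, hℓT⟩ := hinf.exists_notMem_finset (T.image Subtype.val)
  obtain ⟨hℓK, hℓloc⟩ := hℓmem
  refine ⟨⟨ℓ, zhang_isKolyvaginPrime_three_of_gross W K hℓK⟩, fun h ↦ hℓT (Finset.mem_image.mpr ⟨_, h, rfl⟩), ?_⟩
  intro i v hv
  exact hℓloc i v hv

/-- **(Cheb1) for the S2 engine, PROVED**: over any apparatus with `ZMod 3`-linear localisations `loc (Sum.inr v)` at
the finite places satisfying the strict-vanishing dictionary `x ∈ torsionLocalKer_v ↔ loc_v x = 0`, every non-zero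
class of `H¹(K, E[3])` has non-zero localisation at the place of some Zhang–Kolyvagin prime outside any finite set.
Proof: split `x = 2(x⁺ + x⁻)` into `τ`-eigen-components (`3x = 0`); McCallum Cor. 3.2 for the non-zero ones with
exponent pattern `(1, 0)`. [cite: WZhang2014, Lemma 8.1] [cite: McCallumLMS1991, Cor. 3.2] -/
theorem cheb_one_of_mcCallum (hK : IsImaginaryQuadratic K) (hmult : W.HasMultiplicativeReductionAtPrime 3)
    (hsurj : W.HasSurjectiveModNGaloisRep 3) (hc : c ≠ 1)
    {Hv : Place K → Type} [∀ v, AddCommGroup (Hv v)] [∀ v, Module (ZMod 3) (Hv v)]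
    (loc : (v : Place K) → V3 W K →ₗ[ZMod 3] Hv v)
    (plK : {ℓ // Zhang2014.IsKolyvaginPrime (W.conductorNorm ℤ) W K 3 ℓ} → HeightOneSpectrum (𝓞 K))
    (hplK : ∀ ℓ, ((ℓ : ℕ) : 𝓞 K) ∈ (plK ℓ).asIdeal)
    (hZero : ∀ (v : HeightOneSpectrum (𝓞 K)) (x : V3 W K),
      x ∈ (W.baseChange K).torsionLocalKer (v.adicCompletion K) ((3 ^ 1 : ℕ) : ℤ) ↔ loc (Sum.inr v) x = 0) :
    ∀ x : V3 W K, x ≠ 0 → ∀ T : Finset {ℓ // Zhang2014.IsKolyvaginPrime (W.conductorNorm ℤ) W K 3 ℓ},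
      ∃ ℓ, ℓ ∉ T ∧ loc (Sum.inr (plK ℓ)) x ≠ 0 := by
  intro x hx0 T
  have hcc : c * c = 1 := algEquiv_mul_self_eq_one K hK c
  have hττ : ∀ z, conjAct W c ((3 ^ 1 : ℕ) : ℤ) (conjAct W c ((3 ^ 1 : ℕ) : ℤ) z) = z :=
    conjAct_conjAct_of_mul_self W hcc ((3 ^ 1 : ℕ) : ℤ)
  -- eigen-components: u = x + τx (sign +1), w = x − τx (sign −1), x = 2 • (u + w)
  set u := x + conjAct W c ((3 ^ 1 : ℕ) : ℤ) x with hu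
  set w := x - conjAct W c ((3 ^ 1 : ℕ) : ℤ) x with hw
  have hτu : conjAct W c ((3 ^ 1 : ℕ) : ℤ) u = (1 : ℤ) • u := by
    rw [hu, map_add, hττ, one_zsmul, add_comm]
  have hτw : conjAct W c ((3 ^ 1 : ℕ) : ℤ) w = (-1 : ℤ) • w := by
    rw [hw, map_sub, hττ, neg_one_zsmul, neg_sub]
  have hx2 : x = (2 : ℤ) • (u + w) := by
    have huw : u + w = (2 : ℤ) • x := by rw [hu, hw, two_zsmul]; abel
    rw [huw, ← mul_zsmul, show (2 * 2 : ℤ) = 1 + 3 by norm_num, add_zsmul, one_zsmul, three_smul_eq_zero W K x,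
      add_zero]
  have hlocx : ∀ v : Place K, loc v x = (2 : ℤ) • (loc v u + loc v w) := fun v ↦ by
    rw [hx2, map_zsmul, map_add]
  -- independence of a single non-zero class
  have hind1 : ∀ {z : V3 W K}, z ≠ 0 → ∀ a : Fin 1 → ℤ, ∑ i, a i • (![z] i) = 0 → ∀ i, (3 : ℤ) ∣ a i := by
    intro z hz a ha i
    fin_cases i
    simp only [Fin.sum_univ_one, Matrix.cons_val_zero] at ha
    exact dvd_of_zsmul_eq_zero W K hz ha
  by_cases hu0 : u = 0
  · -- then w ≠ 0 and x = 2 • w: McCallum for (w), exponent 1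
    have hw0 : w ≠ 0 := fun h ↦ hx0 (by rw [hx2, hu0, h, add_zero, zsmul_zero])
    obtain ⟨ℓ, hℓT, hℓ⟩ := exists_zhangKolyvaginPrime_notMem_of_eigen W K c hK hmult hsurj hc ![w]
      (fun i ↦ ⟨-1, Or.inr rfl, by fin_cases i; simpa using hτw⟩) ![1] (fun i ↦ by fin_cases i; simp)
      (hind1 hw0) T
    refine ⟨ℓ, hℓT, fun h0 ↦ ?_⟩
    have hwloc : loc (Sum.inr (plK ℓ)) w ≠ 0 := fun h ↦ by
      have := (hℓ 0 (plK ℓ) (hplK ℓ)).mp ((hZero _ _).mpr (by simpa using h))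
      simp at this
    refine hwloc (eq_zero_of_two_zsmul_eq_zero_of_module ?_)
    have := hlocx (Sum.inr (plK ℓ))
    rw [hu0, map_zero, zero_add] at this
    rw [← this, h0]
  · by_cases hw0 : w = 0
    · -- x = 2 • u: McCallum for (u), exponent 1
      obtain ⟨ℓ, hℓT, hℓ⟩ := exists_zhangKolyvaginPrime_notMem_of_eigen W K c hK hmult hsurj hc ![u]
        (fun i ↦ ⟨1, Or.inl rfl, by fin_cases i; simpa using hτu⟩) ![1] (fun i ↦ by fin_cases i; simp)
        (hind1 hu0) T
      refine ⟨ℓ, hℓT, fun h0 ↦ ?_⟩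
      have huloc : loc (Sum.inr (plK ℓ)) u ≠ 0 := fun h ↦ by
        have := (hℓ 0 (plK ℓ) (hplK ℓ)).mp ((hZero _ _).mpr (by simpa using h))
        simp at this
      refine huloc (eq_zero_of_two_zsmul_eq_zero_of_module ?_)
      have := hlocx (Sum.inr (plK ℓ))
      rw [hw0, map_zero, add_zero] at this
      rw [← this, h0]
    · -- both non-zero: McCallum for (u, w), exponents (1, 0): loc u ≠ 0 and loc w = 0
      obtain ⟨ℓ, hℓT, hℓ⟩ := exists_zhangKolyvaginPrime_notMem_of_eigen W K c hK hmult hsurj hc ![u, w]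
        (fun i ↦ by
          fin_cases i
          · exact ⟨1, Or.inl rfl, by simpa using hτu⟩
          · exact ⟨-1, Or.inr rfl, by simpa using hτw⟩)
        ![1, 0] (fun i ↦ by fin_cases i <;> simp)
        (fun a ha ↦ by
          simp only [Fin.sum_univ_two, Matrix.cons_val_zero, Matrix.cons_val_one] at ha
          have h := dvd_and_dvd_of_zsmul_add_zsmul_eq_zero W K (conjAct W c ((3 ^ 1 : ℕ) : ℤ)) (e := 1)
            (Or.inl rfl) hτu (by simpa using hτw) hu0 hw0 ha
          intro i
          fin_cases i
          · exact h.1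
          · exact h.2) T
      refine ⟨ℓ, hℓT, fun h0 ↦ ?_⟩
      have huloc : loc (Sum.inr (plK ℓ)) u ≠ 0 := fun h ↦ by
        have := (hℓ 0 (plK ℓ) (hplK ℓ)).mp ((hZero _ _).mpr (by simpa using h))
        simp at this
      have hwloc : loc (Sum.inr (plK ℓ)) w = 0 := by
        have := (hℓ 1 (plK ℓ) (hplK ℓ)).mpr (by simp)
        exact (hZero _ _).mp (by simpa using this)
      refine huloc (eq_zero_of_two_zsmul_eq_zero_of_module ?_)
      have := hlocx (Sum.inr (plK ℓ))
      rw [hwloc, add_zero] at this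
      rw [← this, h0]

/-- **(Cheb2) for the S2 engine, PROVED**: two non-zero classes of OPPOSITE signs (eigenspaces `E s`, `E (¬s)` of
complex conjugation, dictionary `hE`) are simultaneously non-zero at the place of some Zhang–Kolyvagin prime outside
any finite set — McCallum Cor. 3.2 with exponent pattern `(1, 1)` (independence of opposite eigenclasses).
[cite: WZhang2014, Lemma 8.1] [cite: McCallumLMS1991, Prop. 3.1, Cor. 3.2] -/
theorem cheb_two_of_mcCallum (hK : IsImaginaryQuadratic K) (hmult : W.HasMultiplicativeReductionAtPrime 3)
    (hsurj : W.HasSurjectiveModNGaloisRep 3) (hc : c ≠ 1)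
    {Hv : Place K → Type} [∀ v, AddCommGroup (Hv v)] [∀ v, Module (ZMod 3) (Hv v)]
    (loc : (v : Place K) → V3 W K →ₗ[ZMod 3] Hv v) (E : Bool → Submodule (ZMod 3) (V3 W K))
    (plK : {ℓ // Zhang2014.IsKolyvaginPrime (W.conductorNorm ℤ) W K 3 ℓ} → HeightOneSpectrum (𝓞 K))
    (hplK : ∀ ℓ, ((ℓ : ℕ) : 𝓞 K) ∈ (plK ℓ).asIdeal)
    (hE : ∀ (s : Bool) (x : V3 W K), x ∈ E s ↔ conjAct W c ((3 ^ 1 : ℕ) : ℤ) x = sgn s • x)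
    (hZero : ∀ (v : HeightOneSpectrum (𝓞 K)) (x : V3 W K),
      x ∈ (W.baseChange K).torsionLocalKer (v.adicCompletion K) ((3 ^ 1 : ℕ) : ℤ) ↔ loc (Sum.inr v) x = 0) :
    ∀ (s : Bool), ∀ x ∈ E s, ∀ y ∈ E (!s), x ≠ 0 → y ≠ 0 →
      ∀ T : Finset {ℓ // Zhang2014.IsKolyvaginPrime (W.conductorNorm ℤ) W K 3 ℓ},
      ∃ ℓ, ℓ ∉ T ∧ loc (Sum.inr (plK ℓ)) x ≠ 0 ∧ loc (Sum.inr (plK ℓ)) y ≠ 0 := by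
  intro s x hx y hy hx0 hy0 T
  have hxτ := (hE s x).mp hx
  have hyτ := (hE (!s) y).mp hy
  have hsgn : sgn (!s) = -sgn s := by cases s <;> rfl
  have hes : sgn s = 1 ∨ sgn s = -1 := by cases s <;> simp [sgn]
  rw [hsgn] at hyτ
  obtain ⟨ℓ, hℓT, hℓ⟩ := exists_zhangKolyvaginPrime_notMem_of_eigen W K c hK hmult hsurj hc ![x, y]
    (fun i ↦ by
      fin_cases i
      · exact ⟨sgn s, hes, by simpa using hxτ⟩
      · refine ⟨-sgn s, ?_, by simpa using hyτ⟩
        rcases hes with h | h <;> simp [h])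
    ![1, 1] (fun i ↦ by fin_cases i <;> simp)
    (fun a ha ↦ by
      simp only [Fin.sum_univ_two, Matrix.cons_val_zero, Matrix.cons_val_one] at ha
      have h := dvd_and_dvd_of_zsmul_add_zsmul_eq_zero W K (conjAct W c ((3 ^ 1 : ℕ) : ℤ)) hes hxτ hyτ hx0 hy0 ha
      intro i
      fin_cases i
      · exact h.1
      · exact h.2) T
  refine ⟨ℓ, hℓT, fun h0 ↦ ?_, fun h0 ↦ ?_⟩
  · have := (hℓ 0 (plK ℓ) (hplK ℓ)).mp ((hZero _ _).mpr (by simpa using h0))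
    simp at this
  · have := (hℓ 1 (plK ℓ) (hplK ℓ)).mp ((hZero _ _).mpr (by simpa using h0))
    simp at this

end Summit.BirchSwinnertonDyer.Rank1Residual.X11b.Three.Koly.Method2

end
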